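import Literature.NumberTheory.EllipticCurves.KubertTateFive
import Literature.NumberTheory.EllipticCurves.Rank1Residual.X11RankOneCertificates.Minimality
import HarnessLib

/-!
# The integral Kubert–Tate model `E_{m,n} = [n − m, −mn, −mn², 0, 0]` of `X₁(5)` is a GLOBAL MINIMAL MODEL
# (`m, n` coprime)

PROOF-ONLY file (theorems only), topic `NumberTheory/EllipticCurves`; sequel of `KubertTateFive`
(`E_{m,n} = kubertTateFive m n = [n − m, −mn, −mn², 0, 0]`, `Δ = m⁵n⁵·Q`, `Q = m² − 11mn − n²`,
`c₄ = m⁴ − 12m³n + 14m²n² + 12mn³ + n⁴`) and the `X₁(5)`-analogue of `KubertTateSevenMinimalModel`.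

For COPRIME integers `m, n` a prime `q` dividing both `c₄(E_{m,n})` and `Δ(E_{m,n})` is `q = 5`
(`kubertTateFive_eq_five_of_prime_dvd_c₄_of_dvd_Δ`): `c₄ ≡ n⁴ (mod m)`, `c₄ ≡ m⁴ (mod n)`, and an explicit Bézout identity
`U·c₄ + V·Q = 5·n⁵` in `ℤ[m,n]` (`kubertTateFive_bezout_c₄`). The wild prime is handled without any tameness
hypothesis: `Q ≡ (m − 3n)² (mod 5)`, `Q(3n + 5k, n) = 25·(k² − kn − n²)` and `(k² − kn − n²)(3n + 5j, n) =
5·(5j² + 5jn + n²)`, so `5⁴ ∤ Q(m,n)` for coprime `m, n` (`not_five_pow_four_dvd_quadForm₅`), i.e.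
`ord₅ Δ(E_{m,n}) ≤ 3` off the multiplicative classes `5 ∣ mn`. Hence no prime has `q¹² ∣ Δ ∧ q⁴ ∣ c₄`
(`kubertTateFive_not_pow_dvd_Δ_and_pow_dvd_c₄`) and Silverman's criterion (AEC VII.1 Rem. 1.1, tree
`isGloballyMinimal_of_int_criterion`) gives **`isGloballyMinimal_kubertTateFive_of_isCoprime`**: `E_{m,n}/ℚ`
is a global minimal model for ALL coprime `m, n` — so its reduction types, `a_p` and conductor exponents are
read off the integer equation itself (geometrically: a prime of additive reduction would carry the point
`(0,0)` of order `5` into `𝔾_a(𝔽_q)`, forcing `q = 5`, and at `5` the model is minimal because `ord₅ Δ ≤ 3`).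

## References

* [SilvermanAEC2009] J. H. Silverman, *AEC*, 2nd ed., III.1 (c₄, Δ), VII.1 Remark 1.1, VIII.8.
* [Kubert1976] D. S. Kubert, Proc. London Math. Soc. (3) 33 (1976), Table 3 (`N = 5`).
* [Knapp1993] A. W. Knapp, *Elliptic Curves*, §V.5 (5.31).
-/

set_option autoImplicit false

namespace WeierstrassCurve

open Literature.NumberTheory.EllipticCurves
open Literature.NumberTheory.EllipticCurves.Rank1Residual.X11RankOneCertificates

section Ring

variable {R : Type*} [CommRing R] (m n : R)

/-- `c₄(E_{m,n}) ≡ n⁴ (mod m)`: `c₄ = n⁴ + m·(m³ − 12m²n + 14mn² + 12n³)`. [cite: SilvermanAEC2009, III.1 (c₄)] -/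
theorem kubertTateFive_c₄_eq_add_mul_left :
    (kubertTateFive m n).c₄ = n ^ 4 + m * (m ^ 3 - 12 * m ^ 2 * n + 14 * m * n ^ 2 + 12 * n ^ 3) := by
  rw [kubertTateFive_c₄]; ring

/-- `c₄(E_{m,n}) ≡ m⁴ (mod n)`: `c₄ = m⁴ + n·(−12m³ + 14m²n + 12mn² + n³)`. [cite: SilvermanAEC2009, III.1 (c₄)] -/
theorem kubertTateFive_c₄_eq_add_mul_right :
    (kubertTateFive m n).c₄ = m ^ 4 + n * (-12 * m ^ 3 + 14 * m ^ 2 * n + 12 * m * n ^ 2 + n ^ 3) := by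
  rw [kubertTateFive_c₄]; ring

/-- **Bézout identity for `c₄` and the quadratic factor `Q = m² − 11mn − n²` of `Δ`**:
`U·c₄ + V·Q = 5·n⁵` with explicit `U, V ∈ ℤ[m,n]` (the resultant of `c₄` and `Q` is a power of `5` times a
power of `n`). [cite: SilvermanAEC2009, III.1 (c₄, Δ)] -/
theorem kubertTateFive_bezout_c₄ :
    (-11 * m + 122 * n) * (kubertTateFive m n).c₄
      + (11 * m ^ 3 - 133 * m ^ 2 * n + 166 * m * n ^ 2 + 117 * n ^ 3) * (m ^ 2 - 11 * m * n - n ^ 2)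
        = 5 * n ^ 5 := by
  rw [kubertTateFive_c₄]; ring

end Ring

section Int

variable (m n : ℤ)

/-- A prime dividing two coprime integers is absurd. [folklore] -/
private theorem not_prime_dvd_coprime₅ {m n : ℤ} (hcop : IsCoprime m n) {q : ℕ} (hq : q.Prime)
    (hm : (q : ℤ) ∣ m) (hn : (q : ℤ) ∣ n) : False := by
  have hu : IsUnit (q : ℤ) := hcop.isUnit_of_dvd' hm hn
  rw [Int.isUnit_iff] at hu
  have h2 : (2 : ℤ) ≤ q := by exact_mod_cast hq.two_le
  omega

/-- **For coprime `m, n`, a prime `q` with `q ∣ c₄(E_{m,n})` and `q ∣ Δ(E_{m,n})` is `q = 5`.**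
(`Δ = m⁵n⁵·Q`; `c₄ ≡ n⁴, m⁴` modulo `m, n`; `U c₄ + V Q = 5 n⁵`.)
[cite: SilvermanAEC2009, III.1 and VII.1 Remark 1.1] -/
theorem kubertTateFive_eq_five_of_prime_dvd_c₄_of_dvd_Δ (hcop : IsCoprime m n) {q : ℕ} (hq : q.Prime)
    (h4 : (q : ℤ) ∣ (kubertTateFive m n).c₄) (hΔ : (q : ℤ) ∣ (kubertTateFive m n).Δ) : q = 5 := by
  have hp : Prime (q : ℤ) := Nat.prime_iff_prime_int.mp hq
  rw [kubertTateFive_Δ] at hΔ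
  -- `q ∣ m`, `q ∣ n` or `q ∣ Q`
  rcases hp.dvd_or_dvd hΔ with h12 | hQ
  · rcases hp.dvd_or_dvd h12 with h1 | h2
    · -- `q ∣ m`: then `q ∣ n⁴`
      have hm : (q : ℤ) ∣ m := hp.dvd_of_dvd_pow h1
      rw [kubertTateFive_c₄_eq_add_mul_left] at h4
      have hn4 : (q : ℤ) ∣ n ^ 4 := (dvd_add_left (dvd_mul_of_dvd_left hm _)).mp h4
      exact (not_prime_dvd_coprime₅ hcop hq hm (hp.dvd_of_dvd_pow hn4)).elim
    · -- `q ∣ n`: then `q ∣ m⁴`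
      have hn : (q : ℤ) ∣ n := hp.dvd_of_dvd_pow h2
      rw [kubertTateFive_c₄_eq_add_mul_right] at h4
      have hm4 : (q : ℤ) ∣ m ^ 4 := (dvd_add_left (dvd_mul_of_dvd_left hn _)).mp h4
      exact (not_prime_dvd_coprime₅ hcop hq (hp.dvd_of_dvd_pow hm4) hn).elim
  · -- `q ∣ Q`: Bézout gives `q ∣ 5 n⁵`
    have hb := kubertTateFive_bezout_c₄ m n
    have h5 : (q : ℤ) ∣ 5 * n ^ 5 := by
      rw [← hb]
      exact dvd_add (dvd_mul_of_dvd_right h4 _) (dvd_mul_of_dvd_right hQ _)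
    rcases hp.dvd_or_dvd h5 with h5' | hn5
    · have h5n : q ∣ 5 := by exact_mod_cast h5'
      exact (Nat.prime_dvd_prime_iff_eq hq (by norm_num)).mp h5n
    · have hn : (q : ℤ) ∣ n := hp.dvd_of_dvd_pow hn5
      -- `Q = m² − n(11m + n)`, so `q ∣ m²`
      have hQ' : (q : ℤ) ∣ m ^ 2 - n * (11 * m + n) := by
        have e : m ^ 2 - 11 * m * n - n ^ 2 = m ^ 2 - n * (11 * m + n) := by ring
        rwa [e] at hQ
      have hm2 : (q : ℤ) ∣ m ^ 2 := (dvd_sub_left (dvd_mul_of_dvd_left hn _)).mp hQ'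
      exact (not_prime_dvd_coprime₅ hcop hq (hp.dvd_of_dvd_pow hm2) hn).elim

/-- The tree's list invariant `discOf` of the integer equation of `E_{m,n}` is `Δ(E_{m,n})`. [cite: SilvermanAEC2009, III.1] -/
theorem discOf_kubertTateFive :
    discOf [n - m, -(m * n), -(m * n ^ 2), 0, 0] = (kubertTateFive m n).Δ := by
  simp only [discOf, invariants, kubertTateFive, Δ, b₂, b₄, b₆, b₈]
  ring

/-- The tree's list invariant `c4Of` of the integer equation of `E_{m,n}` is `c₄(E_{m,n})`. [cite: SilvermanAEC2009, III.1] -/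
theorem c4Of_kubertTateFive :
    c4Of [n - m, -(m * n), -(m * n ^ 2), 0, 0] = (kubertTateFive m n).c₄ := by
  simp only [c4Of, invariants, kubertTateFive, c₄, b₂, b₄]
  ring

/-- `E_{m,n}/ℚ` is the literal rational equation with the integer coefficients of `E_{m,n}/ℤ`.
[cite: Kubert1976, Table 3 (N = 5)] -/
theorem kubertTateFive_rat_eq_mk :
    kubertTateFive (m : ℚ) (n : ℚ) =
      ⟨((n - m : ℤ) : ℚ), ((-(m * n) : ℤ) : ℚ), ((-(m * n ^ 2) : ℤ) : ℚ), ((0 : ℤ) : ℚ), ((0 : ℤ) : ℚ)⟩ := by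
  ext <;> simp only [kubertTateFive] <;> push_cast <;> ring

/-- `E_{m,n}/ℚ` is the base change of the integer equation `[n − m, −mn, −mn², 0, 0]`.
[cite: Kubert1976, Table 3 (N = 5)] -/
theorem kubertTateFive_rat_eq_map_mk :
    kubertTateFive (m : ℚ) (n : ℚ) =
      (⟨n - m, -(m * n), -(m * n ^ 2), 0, 0⟩ : WeierstrassCurve ℤ).map (Int.castRingHom ℚ) := by
  rw [kubertTateFive_rat_eq_mk]
  ext <;> simp [map]

/-- The integer equation `[n − m, −mn, −mn², 0, 0]` IS `kubertTateFive m n` over `ℤ`.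
[cite: Kubert1976, Table 3 (N = 5)] -/
theorem mk_eq_kubertTateFive_int :
    (⟨n - m, -(m * n), -(m * n ^ 2), 0, 0⟩ : WeierstrassCurve ℤ) = kubertTateFive m n := by
  ext <;> simp only [kubertTateFive]

/-! ### The wild prime `5`: `ord₅ Q(m,n) ≤ 3`, so `E_{m,n}` is minimal at `5` too -/

/-- `Q = m² − 11mn − n² = (m − 3n)² − 5·n(m + 2n)`: the quadratic factor of `Δ(E_{m,n})` is a square modulo `5`
(its splitting field `ℚ(√5)` is ramified at `5`). [cite: SilvermanAEC2009, III.1 (Δ)] -/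
theorem quadForm₅_eq_sq_sub_five_mul (m n : ℤ) :
    m ^ 2 - 11 * m * n - n ^ 2 = (m - 3 * n) ^ 2 - 5 * (n * (m + 2 * n)) := by
  ring

/-- On the residue class `m = 3n + 5k`: `Q(3n + 5k, n) = 25·(k² − kn − n²)`. [cite: SilvermanAEC2009, III.1 (Δ)] -/
theorem quadForm₅_three_mul_add (n k : ℤ) :
    (3 * n + 5 * k) ^ 2 - 11 * (3 * n + 5 * k) * n - n ^ 2 = 25 * (k ^ 2 - k * n - n ^ 2) := by
  ring

/-- `k² − kn − n² = (k − 3n)² + 5·n(k − 2n)`. [cite: SilvermanAEC2009, III.1 (Δ)] -/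
theorem normForm₅_eq_sq_add_five_mul (k n : ℤ) :
    k ^ 2 - k * n - n ^ 2 = (k - 3 * n) ^ 2 + 5 * (n * (k - 2 * n)) := by
  ring

/-- On the residue class `k = 3n + 5j`: `(k² − kn − n²)(3n + 5j, n) = 5·(5j² + 5jn + n²)`.
[cite: SilvermanAEC2009, III.1 (Δ)] -/
theorem normForm₅_three_mul_add (n j : ℤ) :
    (3 * n + 5 * j) ^ 2 - (3 * n + 5 * j) * n - n ^ 2 = 5 * (5 * j ^ 2 + 5 * j * n + n ^ 2) := by
  ring

/-- **`5⁴ ∤ Q(m,n) = m² − 11mn − n²` for coprime `m, n`**: `5 ∣ Q` forces `m ≡ 3n (mod 5)`, then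
`Q = 25·K` with `K = k² − kn − n²`; `5 ∣ K` forces `k ≡ 3n (mod 5)`, then `K = 5·(5j² + 5jn + n²)` with
`5 ∤ n`. So `ord₅ Q ∈ {0, 2, 3}` and `ord₅ Δ(E_{m,n}) ≤ 3` off the multiplicative classes `5 ∣ mn`.
[cite: SilvermanAEC2009, VII.1 Remark 1.1] -/
theorem not_five_pow_four_dvd_quadForm₅ (hcop : IsCoprime m n) :
    ¬ (5 : ℤ) ^ 4 ∣ m ^ 2 - 11 * m * n - n ^ 2 := by
  have hp : Prime (5 : ℤ) := by norm_num
  intro h625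
  have h5Q : (5 : ℤ) ∣ m ^ 2 - 11 * m * n - n ^ 2 := (dvd_pow_self 5 (by norm_num)).trans h625
  -- `5 ∣ (m − 3n)²`, so `5 ∣ m − 3n`
  rw [quadForm₅_eq_sq_sub_five_mul] at h5Q
  have h53 : (5 : ℤ) ∣ (m - 3 * n) ^ 2 := (dvd_sub_left (dvd_mul_right 5 _)).mp h5Q
  obtain ⟨k, hk⟩ := hp.dvd_of_dvd_pow h53
  have hm : m = 3 * n + 5 * k := by linear_combination hk
  subst hm
  rw [quadForm₅_three_mul_add] at h625
  -- `625 ∣ 25 K` gives `25 ∣ K = k² − kn − n²`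
  have h25K : (25 : ℤ) ∣ k ^ 2 - k * n - n ^ 2 := by
    have e : (5 : ℤ) ^ 4 = 25 * 25 := by norm_num
    rw [e] at h625
    exact (mul_dvd_mul_iff_left (by norm_num : (25 : ℤ) ≠ 0)).mp h625
  have h5K : (5 : ℤ) ∣ k ^ 2 - k * n - n ^ 2 := (show (5 : ℤ) ∣ 25 by norm_num).trans h25K
  -- `5 ∣ (k − 3n)²`, so `5 ∣ k − 3n`
  rw [normForm₅_eq_sq_add_five_mul] at h5K
  have hk3 : (5 : ℤ) ∣ (k - 3 * n) ^ 2 := (dvd_add_left (dvd_mul_right 5 _)).mp h5K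
  obtain ⟨j, hj⟩ := hp.dvd_of_dvd_pow hk3
  have hk : k = 3 * n + 5 * j := by linear_combination hj
  subst hk
  rw [normForm₅_three_mul_add] at h25K
  -- `25 ∣ 5 u` gives `5 ∣ u = 5j² + 5jn + n²`, so `5 ∣ n²`
  have h5u : (5 : ℤ) ∣ 5 * j ^ 2 + 5 * j * n + n ^ 2 := by
    have e : (25 : ℤ) = 5 * 5 := by norm_num
    rw [e] at h25K
    exact (mul_dvd_mul_iff_left (by norm_num : (5 : ℤ) ≠ 0)).mp h25K
  have hn2 : (5 : ℤ) ∣ n ^ 2 := by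
    have e : 5 * j ^ 2 + 5 * j * n + n ^ 2 = 5 * (j ^ 2 + j * n) + n ^ 2 := by ring
    rw [e] at h5u
    exact (dvd_add_right (dvd_mul_right 5 _)).mp h5u
  have hn : (5 : ℤ) ∣ n := hp.dvd_of_dvd_pow hn2
  have hm : (5 : ℤ) ∣ 3 * n + 5 * (3 * n + 5 * j) := dvd_add (dvd_mul_of_dvd_right hn 3) (dvd_mul_right 5 _)
  exact not_prime_dvd_coprime₅ hcop (q := 5) (by norm_num) (by exact_mod_cast hm) (by exact_mod_cast hn)

/-- **No prime `q` has `q¹² ∣ Δ(E_{m,n})` and `q⁴ ∣ c₄(E_{m,n})` when `m, n` are coprime** — with NO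
tameness hypothesis: such a `q` is `5` with `5 ∤ mn` (else `c₄` is a `5`-unit), whence `5¹² ∣ Q`,
contradicting `5⁴ ∤ Q`. [cite: SilvermanAEC2009, VII.1 Remark 1.1] -/
theorem kubertTateFive_not_pow_dvd_Δ_and_pow_dvd_c₄ (hcop : IsCoprime m n) {q : ℕ} (hq : q.Prime) :
    ¬ ((q : ℤ) ^ 12 ∣ (kubertTateFive m n).Δ ∧ (q : ℤ) ^ 4 ∣ (kubertTateFive m n).c₄) := by
  rintro ⟨h12, h4⟩
  have hqΔ : (q : ℤ) ∣ (kubertTateFive m n).Δ := (dvd_pow_self (q : ℤ) (by norm_num)).trans h12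
  have hqc : (q : ℤ) ∣ (kubertTateFive m n).c₄ := (dvd_pow_self (q : ℤ) (by norm_num)).trans h4
  have h := kubertTateFive_eq_five_of_prime_dvd_c₄_of_dvd_Δ m n hcop hq hqc hqΔ
  subst h
  have hp : Prime ((5 : ℕ) : ℤ) := Nat.prime_iff_prime_int.mp hq
  -- `5 ∤ m`, `5 ∤ n` (else `c₄` would be a unit mod `5`)
  have hm : ¬ ((5 : ℕ) : ℤ) ∣ m := fun hm ↦ by
    rw [kubertTateFive_c₄_eq_add_mul_left] at hqc
    have hn4 : ((5 : ℕ) : ℤ) ∣ n ^ 4 := (dvd_add_left (dvd_mul_of_dvd_left hm _)).mp hqc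
    exact not_prime_dvd_coprime₅ hcop hq hm (hp.dvd_of_dvd_pow hn4)
  have hn : ¬ ((5 : ℕ) : ℤ) ∣ n := fun hn ↦ by
    rw [kubertTateFive_c₄_eq_add_mul_right] at hqc
    have hm4 : ((5 : ℕ) : ℤ) ∣ m ^ 4 := (dvd_add_left (dvd_mul_of_dvd_left hn _)).mp hqc
    exact not_prime_dvd_coprime₅ hcop hq (hp.dvd_of_dvd_pow hm4) hn
  -- strip the unit factors `m⁵ n⁵` from `5¹² ∣ Δ`
  rw [kubertTateFive_Δ] at h12
  have h1 : ¬ ((5 : ℕ) : ℤ) ∣ m ^ 5 := fun h ↦ hm (hp.dvd_of_dvd_pow h)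
  have h2 : ¬ ((5 : ℕ) : ℤ) ∣ n ^ 5 := fun h ↦ hn (hp.dvd_of_dvd_pow h)
  have h12' : ¬ ((5 : ℕ) : ℤ) ∣ m ^ 5 * n ^ 5 := by
    intro h
    rcases hp.dvd_or_dvd h with h' | h'
    · exact h1 h'
    · exact h2 h'
  have hQ12 : ((5 : ℕ) : ℤ) ^ 12 ∣ m ^ 2 - 11 * m * n - n ^ 2 :=
    hp.pow_dvd_of_dvd_mul_left 12 h12' h12
  have hQ4 : (5 : ℤ) ^ 4 ∣ m ^ 2 - 11 * m * n - n ^ 2 :=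
    (pow_dvd_pow (5 : ℤ) (by norm_num : 4 ≤ 12)).trans (by exact_mod_cast hQ12)
  exact not_five_pow_four_dvd_quadForm₅ m n hcop hQ4

/-- **`E_{m,n}/ℚ = [n − m, −mn, −mn², 0, 0]` is a global minimal model for ALL coprime `m, n`** (Tate normal form
with a point of order `5`: multiplicative at the primes of `mn`, `ord₅ Δ ∈ {2, 3}` in the wild case `5 ∣ Q`, good
elsewhere off `Q`; Silverman's criterion at every prime). [cite: SilvermanAEC2009, VII.1 Remark 1.1 and VIII.8]
[cite: Kubert1976, Table 3 (N = 5)] -/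
theorem isGloballyMinimal_kubertTateFive_of_isCoprime (hcop : IsCoprime m n) :
    (kubertTateFive (m : ℚ) (n : ℚ)).IsGloballyMinimal := by
  have key := isGloballyMinimal_of_int_criterion (n - m) (-(m * n)) (-(m * n ^ 2)) 0 0 fun q hq hdvd ↦ by
    rw [discOf_kubertTateFive, c4Of_kubertTateFive] at hdvd
    exact kubertTateFive_not_pow_dvd_Δ_and_pow_dvd_c₄ m n hcop hq hdvd
  rw [kubertTateFive_rat_eq_mk]
  exact key

end Int

end WeierstrassCurve
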